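import Mathlib
import Summits.NavierStokesRegularity.NavierStokesRegularity.Theorems.EulerZoomLiouvillePowerGaugeEulerLiouvilleSelfSimilarGenericHyperbolic
import Literature.Dynamics.FixedPoints.DominatedUnstableSetNull
import HarnessLib

/-!
# Rung C1 of the crux `EulerZoomLiouville.PowerGaugeEulerLiouville`: the backward basin of a DEGENERATE stagnation
# point with a dominated contracting direction is Lebesgue-null — thin nodes without hyperbolicity
# (route №10, item stmt-NavierStokesRegularity-19832; `--supports`)

Helper file (theorems only). Seat ns-typeII-p3 (cell ns-regularity-ideate §B, D-0081).  After typeII-p2's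
`NodalFiniteness.eq_zero_of_countable_nodalSet` (a `C²` in-window profile with (3.8) and COUNTABLE stagnation set is
trivial), the classical residue of rung C1 is profiles whose stagnation set is UNCOUNTABLE — stagnation curves /
surfaces, on which the linearisation `DW(z) = γI + DV(z)` is DEGENERATE (`0 ∈ spec`, the tangent direction); the
survivor portrait of typeII-p1 g7 is `spec DW(z) = {s + γ, 0, 2γ − s}`, `s ≥ 1`.  Such a node is not hyperbolic, so
neither the Stable Manifold fact nor `UnstableSetNull` applies; but it has ONE STRICTLY CONTRACTING DIRECTION
(`2γ − s < 0`) DOMINATED by the rest (`0`, `s + γ`), and the dominated cone lemma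
(`Literature.Dynamics.FixedPoints.addHaar_setOf_tendsto_atBot_eq_zero_of_dominated`) makes its backward basin null:

* `norm_exp_smul_apply_le_of_eigenline` / `le_norm_exp_smul_apply_of_span_pair` — rates of `exp(T·A)` on the
  eigenline `span{b₂}` (`= e^{d₂T}`) and on the block plane `span{b₀,b₁}` (`≥ √(g₀/‖G‖)·e^{min(d₀,d₁)T}`, Lyapunov
  pair of `exists_adapted_on_span_pair`);
* **`volume_setOf_tendsto_flow_atBot_eq_zero_of_dominatedBlock`** — `V` smooth with `‖DV‖ ≤ K`, `z ∈ 𝒩_W`, and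
  `DW(z)` in real block normal form `A b₀ = d₀b₀ − βb₁`, `A b₁ = βb₀ + d₁b₁`, `A b₂ = d₂b₂` with
  `d₂ < 0`, `d₂ < d₀`, `d₂ < d₁` (NO sign condition on `d₀, d₁`: `0` allowed) ⇒
  `volume {y : Φ_s y → z as s → −∞} = 0`.  Covers the degenerate portrait (`β = 0`, `(d₀, d₁, d₂) = (s+γ, 0, 2γ−s)`),
  the vortical curve nodes (`(1+γ, 0, 2γ−1)`), and re-covers the generic saddles.

Refuter/planner reading: for the uncountable residue, vorticity can only be fed (backward) by orbits that do NOT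
converge to a single stagnation point, or converge to nodes whose linearisation has NO eigenvalue below the other
two (no dominated contracting direction: e.g. `spec = {0, μ, μ̄}` or a contracting direction that is not the bottom of
a real block form).  The remaining analytic step for stagnation CURVES is single-point convergence of backward orbits
accumulating on the curve (drift control: tangential speed `O(|W|²)` vs `∫|W|² ds < ∞` from the Bernoulli function).

WHAT THIS IS NOT: not NS, not E, not rung C1 — measure-zero statement for backward basins of individual degenerate
nodes of classical profiles.  [folklore; cf. Robinson1999 Ch. V §5.10.1; HaleMagalhaesOliva2002 Def. 7.2.1;
ConstantinIgnatovaVicol2026Putative §3.5]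
-/

noncomputable section

-- flat `Theorems/<Route><Decl>…` files of one crux share the namespace of the crux (tree convention)
set_option linter.dupNamespace false

open MeasureTheory Set Filter Topology Metric Function InnerProductSpace
open scoped RealInnerProductSpace NNReal ContDiff

namespace Summit.NavierStokesRegularity.NavierStokesRegularity.Theorems.PowerGaugeEulerLiouville.Kelvin

open Literature.Analysis Literature.Analysis.FluidPDE Literature.Dynamics.FixedPoints

variable {γ : ℝ} {V : EuclideanSpace ℝ (Fin 3) → EuclideanSpace ℝ (Fin 3)} {P : EuclideanSpace ℝ (Fin 3) → ℝ}

/-! ### Rates of `exp(T·A)` on the eigenline and on the block plane -/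

/-- On the eigenline `span{b₂}` (`A b₂ = d₂ b₂`): `‖exp(T·A) x‖ ≤ e^{d₂T}‖x‖` for `T ≥ 0` (Grönwall with the
Euclidean Lyapunov pair `⟪Ah,h⟫ = d₂‖h‖²`). [folklore] -/
theorem norm_exp_smul_apply_le_of_eigenline (A : EuclideanSpace ℝ (Fin 3) →L[ℝ] EuclideanSpace ℝ (Fin 3))
    (b : Module.Basis (Fin 3) ℝ (EuclideanSpace ℝ (Fin 3))) (lam : Fin 3 → ℝ) (hA2 : A (b 2) = lam 2 • b 2)
    {x : EuclideanSpace ℝ (Fin 3)} (hx : x ∈ Submodule.span ℝ ({b 2} : Set (EuclideanSpace ℝ (Fin 3))))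
    {T : ℝ} (hT : 0 ≤ T) :
    ‖NormedSpace.exp (T • A) x‖ ≤ Real.exp (lam 2 * T) * ‖x‖ := by
  have hle : ∀ h ∈ Submodule.span ℝ ({b 2} : Set (EuclideanSpace ℝ (Fin 3))),
      ⟪(ContinuousLinearMap.id ℝ _) (A h), h⟫ ≤ -(-lam 2) * ⟪(ContinuousLinearMap.id ℝ _) h, h⟫ := by
    intro h hh
    rw [ContinuousLinearMap.id_apply, ContinuousLinearMap.id_apply,
      inner_apply_self_of_mem_span_singleton A b lam hA2 hh, real_inner_self_eq_norm_sq]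
    ring_nf
    rfl
  have h := inner_exp_smul_apply_le A (ContinuousLinearMap.id ℝ _) (mapsTo_span_singleton_of_blockBasis A b lam hA2)
    (fun u v => by simp) hle hx hT
  rw [ContinuousLinearMap.id_apply, ContinuousLinearMap.id_apply, real_inner_self_eq_norm_sq,
    real_inner_self_eq_norm_sq] at h
  -- `‖y‖² ≤ e^{2 d₂ T}‖x‖²`
  have h2 : ‖NormedSpace.exp (T • A) x‖ ^ 2 ≤ (Real.exp (lam 2 * T) * ‖x‖) ^ 2 := by
    calc ‖NormedSpace.exp (T • A) x‖ ^ 2 ≤ Real.exp (-(2 * -lam 2) * T) * ‖x‖ ^ 2 := h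
      _ = (Real.exp (lam 2 * T) * ‖x‖) ^ 2 := by
          rw [mul_pow, ← Real.exp_nat_mul]; ring_nf
  exact (pow_le_pow_iff_left₀ (norm_nonneg _) (by positivity) two_ne_zero).1 h2

/-- On the block plane `span{b₀,b₁}` (`A b₀ = d₀b₀ − βb₁`, `A b₁ = βb₀ + d₁b₁`) there are `c > 0` (from the Lyapunov
pair of `exists_adapted_on_span_pair`) with `‖exp(T·A) x‖ ≥ c·e^{min(d₀,d₁)T}‖x‖` for `T ≥ 0`. [folklore] -/
theorem le_norm_exp_smul_apply_of_span_pair (A : EuclideanSpace ℝ (Fin 3) →L[ℝ] EuclideanSpace ℝ (Fin 3))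
    (b : Module.Basis (Fin 3) ℝ (EuclideanSpace ℝ (Fin 3))) (lam : Fin 3 → ℝ) (β : ℝ)
    (hA0 : A (b 0) = lam 0 • b 0 - β • b 1) (hA1 : A (b 1) = β • b 0 + lam 1 • b 1) :
    ∃ c : ℝ, 0 < c ∧ ∀ T : ℝ, 0 ≤ T → ∀ x ∈ Submodule.span ℝ ({b 0, b 1} : Set (EuclideanSpace ℝ (Fin 3))),
      c * Real.exp (min (lam 0) (lam 1) * T) * ‖x‖ ≤ ‖NormedSpace.exp (T • A) x‖ := by
  obtain ⟨G, hGsym, ⟨g₀, hg₀, hGpos⟩, hGA⟩ := exists_adapted_on_span_pair A b lam β hA0 hA1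
    (μ₀ := min (lam 0) (lam 1)) (Λ₀ := max (lam 0) (lam 1))
    (min_le_left _ _) (min_le_right _ _) (le_max_left _ _) (le_max_right _ _)
  -- `‖G‖ > 0`
  have hGx : ∀ y, ⟪G y, y⟫ ≤ ‖G‖ * ‖y‖ ^ 2 := fun y => by
    calc ⟪G y, y⟫ ≤ ‖G y‖ * ‖y‖ := real_inner_le_norm _ _
      _ ≤ ‖G‖ * ‖y‖ * ‖y‖ := mul_le_mul_of_nonneg_right (G.le_opNorm y) (norm_nonneg _)
      _ = ‖G‖ * ‖y‖ ^ 2 := by ring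
  have hGn : 0 < ‖G‖ := by
    have hb0 : b 0 ≠ 0 := b.ne_zero 0
    have h1 := hGpos (b 0)
    have h2 := hGx (b 0)
    have h3 : 0 < g₀ * ‖b 0‖ ^ 2 := mul_pos hg₀ (pow_pos (norm_pos_iff.2 hb0) 2)
    by_contra hcon
    push Not at hcon
    have : ‖G‖ = 0 := le_antisymm hcon (norm_nonneg _)
    rw [this, zero_mul] at h2
    linarith
  refine ⟨Real.sqrt (g₀ / ‖G‖), Real.sqrt_pos.2 (div_pos hg₀ hGn), fun T hT x hx => ?_⟩
  have h := inner_exp_smul_apply_ge A G (mapsTo_span_pair_of_blockBasis A b lam β hA0 hA1) hGsym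
    (fun h hh => (hGA h hh).1) hx hT
  set y := NormedSpace.exp (T • A) x with hy
  -- `g₀ e^{2μT} ‖x‖² ≤ ⟪G y, y⟫ ≤ ‖G‖‖y‖²`
  have h1 : g₀ / ‖G‖ * Real.exp (2 * min (lam 0) (lam 1) * T) * ‖x‖ ^ 2 ≤ ‖y‖ ^ 2 := by
    have h2 : Real.exp (2 * min (lam 0) (lam 1) * T) * (g₀ * ‖x‖ ^ 2) ≤ ‖G‖ * ‖y‖ ^ 2 :=
      (mul_le_mul_of_nonneg_left (hGpos x) (Real.exp_pos _).le).trans (h.trans (hGx y))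
    rw [div_mul_eq_mul_div, div_mul_eq_mul_div, div_le_iff₀ hGn]
    nlinarith
  have h3 : (Real.sqrt (g₀ / ‖G‖) * Real.exp (min (lam 0) (lam 1) * T) * ‖x‖) ^ 2 ≤ ‖y‖ ^ 2 := by
    rw [mul_pow, mul_pow, Real.sq_sqrt (div_pos hg₀ hGn).le, ← Real.exp_nat_mul]
    calc g₀ / ‖G‖ * Real.exp (↑2 * (min (lam 0) (lam 1) * T)) * ‖x‖ ^ 2
        = g₀ / ‖G‖ * Real.exp (2 * min (lam 0) (lam 1) * T) * ‖x‖ ^ 2 := by norm_num [mul_assoc]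
      _ ≤ ‖y‖ ^ 2 := h1
  have hnn : 0 ≤ Real.sqrt (g₀ / ‖G‖) * Real.exp (min (lam 0) (lam 1) * T) * ‖x‖ := by positivity
  nlinarith [norm_nonneg y, sq_nonneg (‖y‖ - Real.sqrt (g₀ / ‖G‖) * Real.exp (min (lam 0) (lam 1) * T) * ‖x‖)]

/-! ### The backward basin of a degenerate node with a dominated contracting direction is null -/

/-- **THIN WITHOUT HYPERBOLICITY.**  Let `V` be smooth with `‖DV‖ ≤ K`, `z` a stagnation point of `W = γy + V`, and
suppose `DW(z) = γI + DV(z)` has the real block normal form `A b₀ = d₀b₀ − βb₁`, `A b₁ = βb₀ + d₁b₁`, `A b₂ = d₂b₂`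
with `d₂ < 0`, `d₂ < d₀`, `d₂ < d₁` — one strictly contracting direction dominated by the block plane, with NO sign
condition on `d₀, d₁` (the degenerate portrait `(s+γ, 0, 2γ−s)` of a node on a stagnation curve is the case `β = 0`,
`d₁ = 0`).  Then the set of points whose backward trajectory under the similarity flow converges to `z` is
Lebesgue-null. [cite: Robinson1999, Ch. V §5.10.1 (cone estimate, dominated form; proved in the tree)] -/
theorem volume_setOf_tendsto_flow_atBot_eq_zero_of_dominatedBlock (hV : ContDiff ℝ ∞ V) {K : ℝ}
    (hK : ∀ y, ‖fderiv ℝ V y‖ ≤ K) {z : EuclideanSpace ℝ (Fin 3)} (hz : z ∈ selfSimilarNodalSet γ 0 V)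
    (b : Module.Basis (Fin 3) ℝ (EuclideanSpace ℝ (Fin 3))) (lam : Fin 3 → ℝ) (β : ℝ)
    (hA0 : (γ • ContinuousLinearMap.id ℝ (EuclideanSpace ℝ (Fin 3)) + fderiv ℝ V z) (b 0) = lam 0 • b 0 - β • b 1)
    (hA1 : (γ • ContinuousLinearMap.id ℝ (EuclideanSpace ℝ (Fin 3)) + fderiv ℝ V z) (b 1) = β • b 0 + lam 1 • b 1)
    (hA2 : (γ • ContinuousLinearMap.id ℝ (EuclideanSpace ℝ (Fin 3)) + fderiv ℝ V z) (b 2) = lam 2 • b 2)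
    (h2 : lam 2 < 0) (h20 : lam 2 < lam 0) (h21 : lam 2 < lam 1) :
    volume {y : EuclideanSpace ℝ (Fin 3) |
      Tendsto (fun s => ODE.evolutionMap (fun _ : ℝ => selfSimilarTransport γ 0 V) 0 s y) atBot (𝓝 z)} = 0 := by
  set A : EuclideanSpace ℝ (Fin 3) →L[ℝ] EuclideanSpace ℝ (Fin 3) :=
    γ • ContinuousLinearMap.id ℝ (EuclideanSpace ℝ (Fin 3)) + fderiv ℝ V z with hA
  obtain ⟨c, hc, hplane⟩ := le_norm_exp_smul_apply_of_span_pair A b lam β hA0 hA1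
  set μ : ℝ := min (lam 0) (lam 1) with hμ
  have hμ2 : lam 2 < μ := lt_min h20 h21
  -- choose `T > 0` with `e^{d₂T} < c e^{μT}`, i.e. `e^{(μ−d₂)T} > 1/c`
  set κ : ℝ := μ - lam 2 with hκ
  have hκ0 : 0 < κ := by rw [hκ]; linarith
  set T : ℝ := (1 / c) / κ + 1 with hTdef
  have hT0 : 0 < T := by rw [hTdef]; positivity
  have hrate : Real.exp (lam 2 * T) < c * Real.exp (μ * T) := by
    have h1 : 1 / c < Real.exp (κ * T) := by
      have h2 : κ * T = 1 / c + κ := by rw [hTdef]; field_simp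
      have h3 := Real.add_one_le_exp (κ * T)
      rw [h2] at h3 ⊢
      linarith
    have h4 : Real.exp (μ * T) = Real.exp (lam 2 * T) * Real.exp (κ * T) := by
      rw [← Real.exp_add]; congr 1; rw [hκ]; ring
    rw [h4]
    have h5 : 1 < c * Real.exp (κ * T) := by
      have := (div_lt_iff₀' hc).1 h1
      linarith
    nlinarith [Real.exp_pos (lam 2 * T)]
  -- the time-`T` map and its derivative at `z`
  have hexp := fderiv_flow_eq_exp_smul hV hK hz T
  refine addHaar_setOf_tendsto_atBot_eq_zero_of_dominated volume
    (Φ := ODE.evolutionMap (fun _ : ℝ => selfSimilarTransport γ 0 V) 0) flow_zero (flow_add (γ := γ) hV hK)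
    hT0 ((contDiff_flow (γ := γ) hV hK T).of_le (by norm_cast)) (p := z)
    (Es := Submodule.span ℝ {b 2}) (Ec := Submodule.span ℝ {b 0, b 1}) (isCompl_span_singleton_span_pair b)
    (fun x hx => ?_) (fun x hx => ?_) (a := Real.exp (lam 2 * T)) (b := c * Real.exp (μ * T)) ?_ hrate
    (fun x hx => ?_) (fun x hx => ?_) (span_pair_ne_top b)
  · rw [hexp]; exact exp_smul_apply_mem A (mapsTo_span_singleton_of_blockBasis A b lam hA2) hx T
  · rw [hexp]; exact exp_smul_apply_mem A (mapsTo_span_pair_of_blockBasis A b lam β hA0 hA1) hx T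
  · -- `e^{d₂ T} < 1`
    have : lam 2 * T < 0 := mul_neg_of_neg_of_pos h2 hT0
    calc Real.exp (lam 2 * T) < Real.exp 0 := Real.exp_lt_exp.2 this
      _ = 1 := Real.exp_zero
  · rw [hexp]; exact norm_exp_smul_apply_le_of_eigenline A b lam hA2 hx hT0.le
  · rw [hexp]; exact hplane T hT0.le x hx

end Summit.NavierStokesRegularity.NavierStokesRegularity.Theorems.PowerGaugeEulerLiouville.Kelvin

end
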